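import Summits.Ventures.LatticeQCDFlow.Exactness.IMHCoupledUnbiasedEstimatorUnboundedWeights
import HarnessLib

/-!
# The observable total-variation diagnostic WITHOUT a weight bound: under a lag-one coupling whose marginals integrate the weight,
# `|π f − E f(Y_b)| ≤ (c − a)·Σ_{n≥0} P(X_{b+n} ≠ X′_{b+n})` and `|π(S) − P(Y_b ∈ S)| ≤ Σ_{n≥0} P(X_{b+n} ≠ X′_{b+n})`

HONEST FRAMING: exact (Metropolis-corrected) sampling algorithms for lattice gauge theory;
figures of merit are autocorrelation/cost numbers at stated couplings and volumes; no
continuum-physics claim.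

Venture `LatticeQCDFlow` (cell pub-lqcd), topic `Exactness`; FANOUT row 30 (lean-1, GEN-40).  NEW WORK of the cell (standard Borel `Ω`,
`MeasurableEq Ω`; EVERY proposal law — atoms allowed, via this generation's `…AnyCouplingAtoms`); sequel to GEN-39's `Exactness/IMHCouplingTotalVariationDiagnostic` (the same statements for a NORMALISED
weight with a mode `w ≤ W` — the coupling-based convergence diagnostic à la Biswas–Jacob–Vanetti, named only) and to this generation's
`…CoupledUnbiasedEstimatorUnboundedWeights` (`Σ_n E[f(X′_{b+n}) − f(Y_{b+n})] = π f − E f(Y_b)` and `Σ_n P(X_n ≠ X′_n) < ∞` WITHOUT a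
weight bound).  Setting: `K = indepMH q w`, `0 < w` measurable, `π = w·q` a probability law with `∫ w dπ = ∫ w² dq < ∞`, NO BOUND ON `w`;
CRN pair kernel `K̂`; lag-one initial coupling `μ̂₀` whose marginals integrate `w`; `a ≤ f ≤ c` measurable:

* **`crn_chain_summable_offDiagonal_shift_unboundedWeights`** — `n ↦ P(X_{b+n} ≠ X′_{b+n})` is summable (from this generation's
  `Σ_n P(X_n ≠ X′_n) ≤ E[max(1, w, w′); Δᶜ]/E_q[min(1, w)] < ∞`);
* **`crnLag_bias_abs_le_tsum_offDiagonal_unboundedWeights`** — `|π f − E f(Y_b)| ≤ (c − a)·Σ_{n≥0} P(X_{b+n} ≠ X′_{b+n})` for every bounded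
  measurable `f` and every `b`;
* **`crnLag_measureReal_sub_abs_le_tsum_offDiagonal_unboundedWeights`** — the total-variation form, for every measurable `S`:
  `|π(S) − P(Y_b ∈ S)| ≤ Σ_{n≥0} P(X_{b+n} ≠ X′_{b+n})`.
THE REMAINING BIAS OF THE PRODUCTION RUN AT TIME `b` IS READ OFF THE COUPLED PAIR, for heavy-tailed weights too: the practitioners'
diagnostic survives beyond uniform ergodicity, at the price of the model second moment `∫ w² dq < ∞`.
Reading (gauge files): for the flow-driven exact gauge sampler with an unbounded importance weight of finite model-second-moment, the expected
number of remaining rounds on which two coupled runs differ bounds the bias of every bounded measurement, in units of its range.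
NOT CLAIMED: the finite-sample certificate of GEN-39's `…Certificate` (its Hoeffding step is weight-free but its `r^{b+m}p₀W` tail is not);
a rate.  No `sorry`, no new definitions, nothing cited as a fact.
-/

noncomputable section

namespace Summit.Ventures.LatticeQCDFlow.Exactness

open MeasureTheory ProbabilityTheory Function Finset Filter Set
open scoped _root_.ENNReal unitInterval Topology
open Summit.Ventures.LatticeQCDFlow.Scoring

variable {Ω : Type*} [MeasurableSpace Ω] {q : Measure Ω} [IsProbabilityMeasure q] {w : Ω → ℝ}

/-- **`n ↦ P(X_{b+n} ≠ X′_{b+n})` IS SUMMABLE WITHOUT A WEIGHT BOUND** for every initial coupling whose off-diagonal part integrates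
`max(1, w, w′)` (standard Borel `Ω`, every proposal law). [ours] -/
theorem crn_chain_summable_offDiagonal_shift_unboundedWeights [StandardBorelSpace Ω] [Nonempty Ω] [MeasurableSingletonClass Ω]
    [MeasurableEq Ω] (hw : Measurable w) (hw0 : ∀ y, 0 < w y)
    (Khat : Kernel (Ω × Ω) (Ω × Ω)) [IsMarkovKernel Khat]
    (hK : ∀ z : Ω × Ω, Khat z = (q.prod (volume : Measure unitInterval)).map (fun p : Ω × unitInterval =>
      ((if (p.2 : ℝ) * w z.1 ≤ w p.1 then p.1 else z.1), (if (p.2 : ℝ) * w z.2 ≤ w p.1 then p.1 else z.2))))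
    (μ₀ : Measure (Ω × Ω)) [IsProbabilityMeasure μ₀]
    (hfin : ∫⁻ p in (Set.diagonal Ω)ᶜ, ENNReal.ofReal (max 1 (max (w p.1) (w p.2))) ∂μ₀ ≠ ∞) (b : ℕ) :
    Summable (fun n : ℕ => ((fun m : Measure (Ω × Ω) => m.bind Khat)^[b + n] μ₀).real (Set.diagonal Ω)ᶜ) := by
  set d : ℕ → ℝ≥0∞ := fun n => ((fun m : Measure (Ω × Ω) => m.bind Khat)^[n] μ₀) (Set.diagonal Ω)ᶜ with hd
  have hc0 : ∫⁻ y, ENNReal.ofReal (min 1 (w y)) ∂q ≠ 0 := by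
    intro h0
    have hae : (fun y => ENNReal.ofReal (min 1 (w y))) =ᵐ[q] 0 :=
      (lintegral_eq_zero_iff (measurable_const.min hw).ennreal_ofReal).1 h0
    have hfalse : ∀ᵐ y ∂q, False := hae.mono fun y hy => by
      have hpos : 0 < ENNReal.ofReal (min 1 (w y)) := ENNReal.ofReal_pos.2 (lt_min one_pos (hw0 y))
      simp only [Pi.zero_apply] at hy
      exact hpos.ne' hy
    rw [ae_iff] at hfalse
    simp at hfalse
  have htsum : ∑' n, d n ≠ ∞ :=
    ne_top_of_le_ne_top (ENNReal.div_ne_top hfin hc0) (tsum_offDiagonal_le_unboundedWeights hw hw0 Khat hK μ₀)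
  have h := (ENNReal.summable_toReal htsum).comp_injective (add_right_injective b)
  simpa [measureReal_def, hd, Function.comp_def] using h

/-- **THE OBSERVABLE DIAGNOSTIC WITHOUT A WEIGHT BOUND**: lag-one coupling whose marginals integrate the weight, `∫ w dπ < ∞`,
`a ≤ f ≤ c` measurable; for every `b`, `|π f − E f(Y_b)| ≤ (c − a)·Σ_{n≥0} P(X_{b+n} ≠ X′_{b+n})`. [ours] -/
theorem crnLag_bias_abs_le_tsum_offDiagonal_unboundedWeights [StandardBorelSpace Ω] [Nonempty Ω] [MeasurableSingletonClass Ω]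
    [MeasurableEq Ω] (hw : Measurable w) (hw0 : ∀ y, 0 < w y)
    [IsProbabilityMeasure (q.withDensity fun y => ENNReal.ofReal (w y))]
    (hπw : ∫⁻ y, ENNReal.ofReal (w y) ∂(q.withDensity fun y => ENNReal.ofReal (w y)) ≠ ∞)
    (Khat : Kernel (Ω × Ω) (Ω × Ω)) [IsMarkovKernel Khat]
    (hK : ∀ z : Ω × Ω, Khat z = (q.prod (volume : Measure unitInterval)).map (fun p : Ω × unitInterval =>
      ((if (p.2 : ℝ) * w z.1 ≤ w p.1 then p.1 else z.1), (if (p.2 : ℝ) * w z.2 ≤ w p.1 then p.1 else z.2))))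
    (μ₀ : Measure (Ω × Ω)) [IsProbabilityMeasure μ₀]
    (hlag : μ₀.map Prod.fst = (μ₀.map Prod.snd).bind (indepMH q w))
    (hμ₁w : ∫⁻ p, ENNReal.ofReal (w p.1) ∂μ₀ ≠ ∞) (hμ₂w : ∫⁻ p, ENNReal.ofReal (w p.2) ∂μ₀ ≠ ∞)
    {f : Ω → ℝ} (hf : Measurable f) {a c : ℝ} (ha : ∀ x, a ≤ f x) (hc : ∀ x, f x ≤ c) (b : ℕ) :
    |∫ x, f x ∂(q.withDensity fun y => ENNReal.ofReal (w y)) -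
        ∫ z, f ((z b).2) ∂(Kernel.trajMeasure (X := fun _ : ℕ => Ω × Ω) μ₀
          (fun n : ℕ => Khat.comap (fun h : (i : ↥(Finset.Iic n)) → Ω × Ω => h ⟨n, Finset.mem_Iic.2 le_rfl⟩)
            (measurable_pi_apply _)))| ≤
      (c - a) * ∑' n, ((fun m : Measure (Ω × Ω) => m.bind Khat)^[b + n] μ₀).real (Set.diagonal Ω)ᶜ := by
  have hhas := crnLag_hasSum_integral_diff_unboundedWeights hw hw0 hπw Khat hK μ₀ hlag hμ₁w hμ₂w hf ha hc b
  have hfin : ∫⁻ p in (Set.diagonal Ω)ᶜ, ENNReal.ofReal (max 1 (max (w p.1) (w p.2))) ∂μ₀ ≠ ∞ :=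
    ne_top_of_le_ne_top (by simpa using ⟨hμ₁w, hμ₂w⟩ : μ₀ Set.univ + ∫⁻ p, ENNReal.ofReal (w p.1) ∂μ₀ +
      ∫⁻ p, ENNReal.ofReal (w p.2) ∂μ₀ ≠ ∞) (lintegral_max_one_le hw hw0 μ₀)
  have hsum := crn_chain_summable_offDiagonal_shift_unboundedWeights hw hw0 Khat hK μ₀ hfin b
  rw [← hhas.tsum_eq]
  have hterm : ∀ n, ‖∫ z, (f ((z (b + n)).1) - f ((z (b + n)).2))
      ∂(Kernel.trajMeasure (X := fun _ : ℕ => Ω × Ω) μ₀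
        (fun n : ℕ => Khat.comap (fun h : (i : ↥(Finset.Iic n)) → Ω × Ω => h ⟨n, Finset.mem_Iic.2 le_rfl⟩)
          (measurable_pi_apply _)))‖ ≤ (c - a) * ((fun m : Measure (Ω × Ω) => m.bind Khat)^[b + n] μ₀).real (Set.diagonal Ω)ᶜ := fun n => by
    rw [Real.norm_eq_abs]
    exact (abs_integral_le_integral_abs).trans (crnLag_integral_abs_diff_le_offDiagonal Khat μ₀ hf ha hc (b + n))
  rw [← Real.norm_eq_abs, ← tsum_mul_left]
  exact tsum_of_norm_bounded (hsum.mul_left (c - a)).hasSum hterm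

/-- **THE TOTAL-VARIATION FORM WITHOUT A WEIGHT BOUND**: for every measurable `S` and every `b`,
`|π(S) − P(Y_b ∈ S)| ≤ Σ_{n≥0} P(X_{b+n} ≠ X′_{b+n})`. [ours] -/
theorem crnLag_measureReal_sub_abs_le_tsum_offDiagonal_unboundedWeights [StandardBorelSpace Ω] [Nonempty Ω]
    [MeasurableSingletonClass Ω] [MeasurableEq Ω] (hw : Measurable w) (hw0 : ∀ y, 0 < w y)
    [IsProbabilityMeasure (q.withDensity fun y => ENNReal.ofReal (w y))]
    (hπw : ∫⁻ y, ENNReal.ofReal (w y) ∂(q.withDensity fun y => ENNReal.ofReal (w y)) ≠ ∞)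
    (Khat : Kernel (Ω × Ω) (Ω × Ω)) [IsMarkovKernel Khat]
    (hK : ∀ z : Ω × Ω, Khat z = (q.prod (volume : Measure unitInterval)).map (fun p : Ω × unitInterval =>
      ((if (p.2 : ℝ) * w z.1 ≤ w p.1 then p.1 else z.1), (if (p.2 : ℝ) * w z.2 ≤ w p.1 then p.1 else z.2))))
    (μ₀ : Measure (Ω × Ω)) [IsProbabilityMeasure μ₀]
    (hlag : μ₀.map Prod.fst = (μ₀.map Prod.snd).bind (indepMH q w))
    (hμ₁w : ∫⁻ p, ENNReal.ofReal (w p.1) ∂μ₀ ≠ ∞) (hμ₂w : ∫⁻ p, ENNReal.ofReal (w p.2) ∂μ₀ ≠ ∞)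
    {S : Set Ω} (hS : MeasurableSet S) (b : ℕ) :
    |(q.withDensity fun y => ENNReal.ofReal (w y)).real S -
        (Kernel.trajMeasure (X := fun _ : ℕ => Ω × Ω) μ₀
          (fun n : ℕ => Khat.comap (fun h : (i : ↥(Finset.Iic n)) → Ω × Ω => h ⟨n, Finset.mem_Iic.2 le_rfl⟩)
            (measurable_pi_apply _))).real {z | (z b).2 ∈ S}| ≤
      ∑' n, ((fun m : Measure (Ω × Ω) => m.bind Khat)^[b + n] μ₀).real (Set.diagonal Ω)ᶜ := by
  have h := crnLag_bias_abs_le_tsum_offDiagonal_unboundedWeights hw hw0 hπw Khat hK μ₀ hlag hμ₁w hμ₂w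
    (measurable_one.indicator hS) (a := 0) (c := 1) (fun x => Set.indicator_nonneg (fun _ _ => zero_le_one) x)
    (fun x => Set.indicator_le_self' (fun _ _ => zero_le_one) x) b
  rw [integral_indicator_one hS, sub_zero, one_mul] at h
  have hfun : (fun z : ℕ → Ω × Ω => S.indicator (1 : Ω → ℝ) ((z b).2)) =
      ({z : ℕ → Ω × Ω | (z b).2 ∈ S}).indicator (1 : (ℕ → Ω × Ω) → ℝ) := by
    funext z
    by_cases hz : (z b).2 ∈ S
    · rw [Set.indicator_of_mem hz, Set.indicator_of_mem (show z ∈ {z : ℕ → Ω × Ω | (z b).2 ∈ S} from hz)]; rfl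
    · rw [Set.indicator_of_notMem hz, Set.indicator_of_notMem (show z ∉ {z : ℕ → Ω × Ω | (z b).2 ∈ S} from hz)]
  have hSm : MeasurableSet {z : ℕ → Ω × Ω | (z b).2 ∈ S} := hS.preimage (measurable_snd.comp (measurable_pi_apply b))
  rw [hfun, integral_indicator_one hSm] at h
  exact h

end Summit.Ventures.LatticeQCDFlow.Exactness

end
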